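import Summits.QuantumFields.YangMills.Theorems.BalabanUVNodesN16UniformScalarSeam
import Summits.QuantumFields.YangMills.Theorems.BalabanUVNodesN16SlotKeyGaugeQuotient
import Summits.QuantumFields.BalabanUV.T4Continuum.Support.MinimalActionExistence
import Summits.QuantumFields.BalabanUV.T4Continuum.Support.NE7CentralTwist
import HarnessLib

/-!
# YM-DAG node N16 (NE3), the re-keyed N07 in-edge — (T8) WITH A `k`-UNIFORM CLASS CONSTANT ON THE FIRST NON-FLAT FAMILY: every `N`-periodic scalar datum of UNIFORM
# CURVATURE `ω` is the `k`-fold average (43) of an `(N·L^k)`-periodic `U(N)`-valued field in the (8)-class `sfClass (d+2) L N e k` for EVERY `e ≥ |ω|` and EVERY run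
# length `k` — the admissible set is non-empty, and (leaf-05) a minimiser exists, at the (8)-radius with a constant INDEPENDENT OF `k` (file 3 of 3 of the g6 piece)

Cell `pub-ymgap`, width seat `pub-ymgap-dag-n16-w2` (director-ym №197 ∕ HUMAN RULING D-0149), generation 6.  `--kind proof --supports stmt-QuantumFields-27366 --as helper`
(K3⁸, KEY MAP v2).  `bears_on: R4∕N16`, edge N07 → N16.  COUNT-NEUTRAL.

HONEST FRAMING.  Kernel bookkeeping over file 1 (`…N16UniformScalarAverage`: the exact `k`-fold average of the Landau field), file 2 (`…N16UniformScalarSeam`: central gauges,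
flux quantisation, the periodic seam field) and landed modules BY NAME ([Balaban1985Averaging] (45) for arbitrary gauges `B7Prop6Flat.avgIter_gaugeAct_units`, this seat's g5
`avgIter_gaugeAct_blkGauge` ∕ `isMinimiser_gaugeAct_blkGauge`, leaf-05's compactness `MinimalActionExistence.exists_isMinimiser_of_nonempty`).  Nothing of Bałaban is asserted or
refuted; DischargeTest `stub_reg910Slot` NOT closed; no K3⁸ v6 stub named or closed; N16 ∕ N07 NOT discharged; counts UNMOVED (typed 28∕28 · discharged 5∕27 · A 5∕28).  R4 closes
the conditional finite-𝕋⁴ rung `BalabanLadder.UV` only; NOT ℝ⁴ ∕ OS ∕ mass gap; the YM mass gap (Clay) is NOT proved by any of this.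

WHY.  This seat's g5 evidence (v1.1 §2 (C1)) located the content of the slot key's existence half (T8) as the `k`-UNIFORMITY of the (8)-class constant `B₃` (fixed-`k` versions
hold at the inflated radius `ε₁L^{2k}`, p620000 §1; on the FLAT moduli `B₃` is free, p620000 §2–§3; at rank two (T8) forces `B₃ ≥ 1`, dag-n16-w1 p618486∕p620319).  Here (C1) is
SETTLED on the first NON-FLAT family — the scalar data of uniform `(e₀,e₁)`-curvature — with `B₃ = 2`, uniformly in `k`, in every dimension `d + 2` (so at `d + 2 = 4`).

WHAT IS PROVED ([folklore], 0 `sorry`, 0 `def`; matrix size `n : Type`).  §4 MONODROMY: `isPeriodicCfg_avgIter'`, `const_of_forall_add_e` (a function on `ℤ^m` invariant under unit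
steps is constant), `units_comm_of_central`, ★ `monodromy_const` (a CENTRAL gauge relating two `N`-periodic configurations has constant monodromy along every period),
`isPeriodicCfg_gaugeAct_blkGauge_of_monodromy` (its block-constant extension keeps `(N·M)`-periodicity).  §5 `abs_le_two_mul_norm_cexp_smul_one_sub_one` (Jordan:
`|ω| ≤ 2‖e^{iω}·1 − 1‖`), ★★★ `exists_periodic_uniform_preimage`: `L ≥ 2`, `N ≥ 1`, `|ω| ≤ 1∕2`, `V` an `N`-periodic `U(N)`-valued SCALAR field whose plaquette variables are
`e^{±iω}·1` on the `(e₀,e₁)`-plane and `1` elsewhere ⟹ for every `k` there is an `(N·L^k)`-periodic `U(N)`-valued `U` with `SmallField U (|ω|∕(L^k)²)` and `avgIter L U k = V`;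
★★ `nonempty_admissible_uniformScalar` (`(admissible (sfClass (d+2) L N e) L k V).Nonempty` for every `e ≥ |ω|` — the CLASS CONSTANT IS INDEPENDENT OF `k`);
★★ `exists_isMinimiser_uniformScalar` (leaf-05's regime); ★★★ `exists8Min_on_uniformScalar`: the slot key's (T8) text
`∀ k ε₁, 0 < ε₁ ≤ C.a₁ → ∀ V ∈ sfClass (d+2) L N ε₁ 0 ∩ 𝒟_unif, ∃ U, IsMinimiser (d+2) (sfClass (d+2) L N (C.B₃·ε₁)) L N (k+1) V U` for EVERY `C : B11Thm1.Consts` with `2 ≤ C.B₃`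
and `C.B₃·C.a₁` inside leaf-05's regime, `𝒟_unif` = the scalar-presented data of uniform `(e₀,e₁)`-curvature (`|ω| ≤ 1`; the radius is read from `sfClass ε₁ 0` by Jordan);
★★ `exists8Min_on_uniformScalar_saturation` (the same on the unitary `N`-periodic gauge orbits).  ROUTE: Landau field `Ũ_f`, `f = ω∕L^{2k}` (file 1: `avgIter L Ũ_f k` is a Landau
field of curvature `ω`) → seam field `U₁` (periodic, same plaquettes as `Ũ_f`, by file 2's `e^{iωN²} = 1`) → `Ũ_f = U₁^{w}`, `V = (avgIter L Ũ_f k)^{v}` (file 2, central gauges) →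
`V = (avgIter L U₁ k)^{y}`, `y = v·(w ∘ L^k)` ((45)) → `y` has constant monodromy (§4) → `U := U₁^{y ∘ ⌊·∕L^k⌋}` is periodic, unitary, uniform-`f`, and `avgIter L U k = V`
(g5 `avgIter_gaugeAct_blkGauge`).  CONSEQUENCE worded for cdisprove ∕ the planners: a refutation of `k`-uniform (T8) needs NON-UNIFORM curvature; and (T9ˢ) is now NON-VACUOUSLY
testable on these data (minimisers exist in the class at `B₃ = 2` for every `k`).

DEPENDENCES (by name): file 1 (`avgIter_landau`, `hol_plaqWord_landau`, `smallField_landau`, `isUnitaryCfg_landau`); file 2 (`exists_central_gauge_of_hol_plaqWord_eq`,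
`cexp_sq_mul_flux_eq_one`, `hol_plaqWord_seam`, `isPeriodicCfg_seam`, `isUnitaryCfg_seam`); `T4AveragingDeficitWallBoundary` (`scalarCfg`, `val_expUnit`, `IsPeriodicCfg`, `fin_zero_ne_one`);
`MinimalActionClassSixNeg.isUnitaryCfg_scalarCfg_imag`; `FederbushMean` (`cexp_smul_one`, `norm_smul_one_sub_one`); `B7Prop6Flat.avgIter_gaugeAct_units`; `B7AvgGaugeCovariance.uLev`;
this seat's g5 `…N16SlotKeyGaugeQuotient` (`gaugeAct_gaugeAct`, `blk_add_mul_smul_e`, `avgIter_gaugeAct_blkGauge`, `isMinimiser_gaugeAct_blkGauge`);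
`MinimalActionLevels.isPeriodicCfg_rescale_bavg`; `AveragingDeficitKDatum.isUnitaryCfg_gaugeAct`; `BlockAverageCurrent.smallField_gaugeAct`; `MinimalActionSandwich` (`admissible`,
`IsMinimiser`); `MinimalActionRate` (`sfClass`, `SmallField.mono`); `MinimalActionExistence.exists_isMinimiser_of_nonempty`; `B7Prop1Explicit` (`disp_treeWord`, `disp_cons`,
`Letter.vec`); Mathlib (`Real.mul_le_sin`, `Complex.norm_exp_I_mul_ofReal_sub_one`, `Real.pi_le_four`).
-/

open scoped BigOperators Matrix Matrix.Norms.L2Operator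
open NormedSpace Finset

namespace Summit.QuantumFields.YangMills.BalabanUVNodes.N16Exists8UniformScalar

open Literature.MathematicalPhysics.QuantumFieldTheory.Balaban1983to89
open B7Prop1Explicit B7Prop2Explicit MatrixLog UnitaryModel
open T4AveragingDeficitWall hiding Site Plane Plaq Bond
open T4AveragingDeficitWallBoundary (scalarCfg hol_scalarCfg val_hol_scalarCfg exp_add_smul_one smul_one_mem_unitary IsPeriodicCfg fin_one_ne_zero
  fin_zero_ne_one)
open FederbushMean (cexp_smul_one norm_smul_one_sub_one norm_smul_one_eq)
open B7Prop6Flat (avgIter_gaugeAct_units)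
open B7AvgGaugeCovariance (uLev uLev_apply)
open Summit.QuantumFields.BalabanUV.T4Continuum
open MinimalActionClassSixNeg (isUnitaryCfg_scalarCfg_imag isPeriodicCfg_scalarCfg norm_cexp_mul_I_smul_one_sub_one_le)
open AveragingDeficitKDatum (isUnitaryCfg_gaugeAct)
open BlockAverageCurrent (smallField_gaugeAct)
open MinimalActionSandwich (IsMinimiser admissible)
open MinimalActionRate (sfClass SmallField.mono)
open MinimalActionExistence (exists_isMinimiser_of_nonempty)
open NE7CentralTwist (units_comm_of_central)
open SmoothRefineBlocks (blk)
open Summit.QuantumFields.YangMills.BalabanUVNodes.N16SlotKeyGaugeQuotient (gaugeAct_gaugeAct blk_add_mul_smul_e avgIter_gaugeAct_blkGauge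
  isMinimiser_gaugeAct_blkGauge)
open Summit.QuantumFields.YangMills.BalabanUVNodes.N16UniformScalarAverage (avgIter_landau hol_plaqWord_landau smallField_landau isUnitaryCfg_landau)
open Summit.QuantumFields.YangMills.BalabanUVNodes.N16UniformScalarSeam (exists_central_gauge_of_hol_plaqWord_eq cexp_sq_mul_flux_eq_one hol_plaqWord_seam
  isPeriodicCfg_seam isUnitaryCfg_seam)

noncomputable section

variable {d : ℕ} {n : Type} [Fintype n] [DecidableEq n]

/-! ## §4 Monodromy: a central gauge relating two periodic configurations -/

/-- The `j`-fold average (43) of an `(Lʲ·P)`-periodic configuration is `P`-periodic (dag-n16-w1 `…N16H7NoBinding.isPeriodicCfg_avgIter`, restated universe-polymorphically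
in the matrix size). [cite: Balaban1985Averaging, (43) p.24] -/
theorem isPeriodicCfg_avgIter' (L : ℕ) :
    ∀ (j : ℕ) {P : ℤ} {U : B7Prop1Explicit.Site d → Fin d → (Matrix n n ℂ)ˣ}, IsPeriodicCfg U ((L : ℤ) ^ j * P) → IsPeriodicCfg (avgIter L U j) P
  | 0, P, U, hU => by simpa using hU
  | j + 1, P, U, hU => by
    rw [avgIter_succ]
    refine MinimalActionLevels.isPeriodicCfg_rescale_bavg L (isPeriodicCfg_avgIter' L j ?_)
    have h : (L : ℤ) ^ j * ((L : ℤ) * P) = (L : ℤ) ^ (j + 1) * P := by ring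
    rw [h]; exact hU

/-- A function on `ℤ^{m}` invariant under every unit step is constant (walk along the tree contour). [folklore] -/
theorem const_of_forall_add_e {α : Type*} {m : B7Prop1Explicit.Site d → α} (h : ∀ (z : B7Prop1Explicit.Site d) (κ : Fin d), m (z + e κ) = m z)
    (z : B7Prop1Explicit.Site d) : m z = m 0 := by
  have hstep : ∀ (l : Letter d) (x : B7Prop1Explicit.Site d), m (x + l.vec) = m x := by
    rintro ⟨κ, b⟩ x
    cases b
    · have := h (x + Letter.vec ((κ, false) : Letter d)) κ
      rw [Letter.vec_false, neg_add_cancel_right] at this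
      rw [Letter.vec_false, ← sub_eq_add_neg]
      rw [← sub_eq_add_neg] at this
      exact this.symm
    · exact h x κ
  have hw : ∀ (w : List (Letter d)) (x : B7Prop1Explicit.Site d), m (x + disp w) = m x := by
    intro w
    induction w with
    | nil => intro x; simp
    | cons l w ih => intro x; rw [disp_cons, ← add_assoc, ih, hstep]
  have := hw (treeWord z) 0
  rwa [disp_treeWord, zero_add] at this

/-- **★ CONSTANT MONODROMY**: if `W` and `W^{y}` are both `N`-periodic and the gauge `y` has central values, then `y(z + N e_ν) = y(z) · m_ν` with the CONSTANT
`m_ν = y(0)⁻¹ y(N e_ν)`. [folklore] -/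
theorem monodromy_const {y : B7Prop1Explicit.Site d → (Matrix n n ℂ)ˣ} (hy : ∀ (z : B7Prop1Explicit.Site d) (X : Matrix n n ℂ), (y z : Matrix n n ℂ) * X = X * y z)
    {W : B7Prop1Explicit.Site d → Fin d → (Matrix n n ℂ)ˣ} {N : ℤ} (hW : IsPeriodicCfg W N) (hV : IsPeriodicCfg (gaugeAct y W) N)
    (z : B7Prop1Explicit.Site d) (ν : Fin d) : y (z + N • e ν) = y z * ((y 0)⁻¹ * y (N • e ν)) := by
  -- `m(z) := y(z)⁻¹ y(z + N e_ν)` is invariant under unit steps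
  have hm : ∀ (x : B7Prop1Explicit.Site d) (κ : Fin d), (y (x + e κ))⁻¹ * y (x + e κ + N • e ν) = (y x)⁻¹ * y (x + N • e ν) := by
    intro x κ
    have h := hV x ν κ
    simp only [gaugeAct] at h
    rw [hW x ν κ, add_right_comm] at h
    -- h : y (x + N•eν) * W x κ * (y (x + eκ + N•eν))⁻¹ = y x * W x κ * (y (x + e κ))⁻¹
    have hc1 := units_comm_of_central (hy (x + N • e ν)) (W x κ)
    have hc2 := units_comm_of_central (hy x) (W x κ)
    rw [hc1, hc2, mul_assoc, mul_assoc] at h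
    have h' := mul_left_cancel h
    -- h' : y (x + N•eν) * (y (x + eκ + N•eν))⁻¹ = y x * (y (x+eκ))⁻¹
    have hyy : ∀ a b : B7Prop1Explicit.Site d, y a * y b = y b * y a := fun a b => units_comm_of_central (hy a) (y b)
    calc (y (x + e κ))⁻¹ * y (x + e κ + N • e ν)
        = (y x)⁻¹ * (y x * (y (x + e κ))⁻¹) * y (x + e κ + N • e ν) := by group
      _ = (y x)⁻¹ * (y (x + N • e ν) * (y (x + e κ + N • e ν))⁻¹) * y (x + e κ + N • e ν) := by rw [h']
      _ = (y x)⁻¹ * y (x + N • e ν) := by group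
  have hconst := const_of_forall_add_e (m := fun x => (y x)⁻¹ * y (x + N • e ν)) hm z
  simp only [zero_add] at hconst
  rw [← hconst, mul_inv_cancel_left]

/-- **THE BLOCK-CONSTANT EXTENSION OF A GAUGE WITH CONSTANT CENTRAL MONODROMY KEEPS PERIODICITY**: if `y(z + N e_ν) = y(z)·m_ν` with central `y`, and `U₁` is
`(N·M)`-periodic, then `U₁^{y ∘ ⌊·∕M⌋}` is `(N·M)`-periodic (`M ≥ 1`). [folklore] -/
theorem isPeriodicCfg_gaugeAct_blkGauge_of_monodromy {M : ℕ} (hM : 1 ≤ M) {N : ℕ} {y : B7Prop1Explicit.Site d → (Matrix n n ℂ)ˣ}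
    (hy : ∀ (z : B7Prop1Explicit.Site d) (X : Matrix n n ℂ), (y z : Matrix n n ℂ) * X = X * y z)
    (hmono : ∀ (z : B7Prop1Explicit.Site d) (ν : Fin d), y (z + (N : ℤ) • e ν) = y z * ((y 0)⁻¹ * y ((N : ℤ) • e ν)))
    {U₁ : B7Prop1Explicit.Site d → Fin d → (Matrix n n ℂ)ˣ} (hU₁ : IsPeriodicCfg U₁ ((N * M : ℕ) : ℤ)) :
    IsPeriodicCfg (gaugeAct (fun x => y (blk M x)) U₁) ((N * M : ℕ) : ℤ) := by
  intro x ν κ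
  simp only [gaugeAct]
  have e1 : ((N * M : ℕ) : ℤ) = (M : ℤ) * (N : ℤ) := by push_cast; ring
  rw [hU₁ x ν κ, e1, add_right_comm, blk_add_mul_smul_e hM, blk_add_mul_smul_e hM, hmono, hmono]
  set m := (y 0)⁻¹ * y ((N : ℤ) • e ν)
  have hmc : ∀ u : (Matrix n n ℂ)ˣ, m * u = u * m := by
    intro u
    show (y 0)⁻¹ * y ((N : ℤ) • e ν) * u = u * ((y 0)⁻¹ * y ((N : ℤ) • e ν))
    have h0 : (y 0)⁻¹ * u = u * (y 0)⁻¹ := by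
      have h := units_comm_of_central (hy 0) u
      calc (y 0)⁻¹ * u = (y 0)⁻¹ * (u * y 0) * (y 0)⁻¹ := by group
        _ = (y 0)⁻¹ * (y 0 * u) * (y 0)⁻¹ := by rw [h]
        _ = u * (y 0)⁻¹ := by group
    rw [mul_assoc, units_comm_of_central (hy _) u, ← mul_assoc, h0, mul_assoc]
  rw [mul_inv_rev, mul_assoc (y (blk M x)) m (U₁ x κ), hmc (U₁ x κ)]
  simp only [mul_assoc, mul_inv_cancel_left]

/-! ## §5 The periodic uniform-curvature preimage, and (T8) with a `k`-uniform class constant on the uniform-curvature scalar data -/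

/-- Jordan's inequality for the scalar plaquette variable: `|ω| ≤ (π∕2)·‖e^{iω}·1 − 1‖` for `|ω| ≤ π`, hence `|ω| ≤ 2·‖e^{iω}·1 − 1‖`. [folklore] -/
theorem abs_le_two_mul_norm_cexp_smul_one_sub_one [Nonempty n] {ω : ℝ} (hω : |ω| ≤ Real.pi) :
    |ω| ≤ 2 * ‖Complex.exp (((ω : ℝ) : ℂ) * Complex.I) • (1 : Matrix n n ℂ) - 1‖ := by
  rw [norm_smul_one_sub_one, mul_comm ((ω : ℝ) : ℂ), Complex.norm_exp_I_mul_ofReal_sub_one]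
  -- `‖2 sin(ω/2)‖ = 2 |sin(ω/2)| ≥ 2·(2/π)·|ω|/2`
  obtain ⟨hωl, hωr⟩ := abs_le.mp hω
  have hs : |Real.sin (ω / 2)| = Real.sin (|ω| / 2) := by
    rcases le_or_gt 0 ω with h | h
    · rw [abs_of_nonneg h, abs_of_nonneg (Real.sin_nonneg_of_nonneg_of_le_pi (by linarith) (by linarith))]
    · rw [abs_of_neg h, abs_of_nonpos (Real.sin_nonpos_of_nonpos_of_neg_pi_le (by linarith) (by linarith)), ← Real.sin_neg, neg_div]
  have hj := Real.mul_le_sin (x := |ω| / 2) (by positivity) (by linarith)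
  rw [Real.norm_eq_abs, abs_mul, abs_two, hs]
  have hπ : (2 : ℝ) / Real.pi * (|ω| / 2) = |ω| / Real.pi := by field_simp
  rw [hπ] at hj
  have hπ3 : Real.pi ≤ 4 := Real.pi_le_four
  have hπ0 : 0 < Real.pi := Real.pi_pos
  have : |ω| ≤ Real.pi * Real.sin (|ω| / 2) := by
    have := mul_le_mul_of_nonneg_left hj hπ0.le
    rwa [mul_div_cancel₀ _ hπ0.ne'] at this
  nlinarith [Real.sin_le_one (|ω| / 2), abs_nonneg ω, Real.sin_nonneg_of_nonneg_of_le_pi (x := |ω| / 2) (by positivity) (by linarith)]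

/-- **★★★ THE PERIODIC UNIFORM-CURVATURE PREIMAGE**: `L ≥ 2`, `N ≥ 1`, `|ω| ≤ 1∕2`; `V = e^{iG}·1` an `N`-periodic `U(N)`-valued SCALAR configuration on `ℤ^{d+2}` whose plaquette
variables are `e^{iω}·1` on `(e₀,e₁)`, `e^{−iω}·1` on `(e₁,e₀)` and `1` on every other plaquette.  Then for every run length `k` there is an `(N·L^k)`-periodic `U(N)`-valued
configuration `U` with `SmallField U (|ω| ∕ (L^k)²)`, `avgIter L U k = V`, and plaquette variables EXACTLY those of the Landau field of curvature `ω∕L^{2k}` (uniform curvature;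
the last clause is what the Jensen step of file 6 compares competitors with). [folklore] -/
theorem exists_periodic_uniform_preimage [Nonempty n] {L : ℕ} (hL : 2 ≤ L) {N : ℕ} (hN : 1 ≤ N) {ω : ℝ} (hω : |ω| ≤ 1 / 2)
    {G : B7Prop1Explicit.Site (d + 2) → Fin (d + 2) → ℝ}
    (hP : IsPeriodicCfg (scalarCfg (n := n) (fun x κ => ((G x κ : ℝ) : ℂ) * Complex.I)) (N : ℤ))
    (hcurv : ∀ (x : B7Prop1Explicit.Site (d + 2)) (κ μ : Fin (d + 2)), κ ≠ μ →
      hol (scalarCfg (n := n) (fun x κ => ((G x κ : ℝ) : ℂ) * Complex.I)) x (plaqWord κ μ)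
        = expUnit ((((if κ = 0 ∧ μ = 1 then ω else if κ = 1 ∧ μ = 0 then -ω else 0 : ℝ) : ℂ) * Complex.I) • (1 : Matrix n n ℂ)))
    (k : ℕ) :
    ∃ U : B7Prop1Explicit.Site (d + 2) → Fin (d + 2) → (Matrix n n ℂ)ˣ,
      IsUnitaryCfg U ∧ IsPeriodicCfg U ((N * L ^ k : ℕ) : ℤ) ∧ SmallField U (|ω| / ((L : ℝ) ^ k) ^ 2) ∧
        avgIter L U k = scalarCfg (n := n) (fun x κ => ((G x κ : ℝ) : ℂ) * Complex.I) ∧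
        ∀ (x : B7Prop1Explicit.Site (d + 2)) (κ μ : Fin (d + 2)), hol U x (plaqWord κ μ)
          = expUnit ((((if κ = 0 ∧ μ = 1 then ω / (L : ℝ) ^ (2 * k) else if κ = 1 ∧ μ = 0 then -(ω / (L : ℝ) ^ (2 * k)) else 0 : ℝ) : ℂ) *
              Complex.I) • (1 : Matrix n n ℂ)) := by
  have hL1 : 1 ≤ L := by omega
  have hL0 : (0 : ℝ) < L := by exact_mod_cast (show 0 < L by omega)
  set V := scalarCfg (n := n) (fun x κ => ((G x κ : ℝ) : ℂ) * Complex.I) with hVdef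
  have hVU : IsUnitaryCfg V := isUnitaryCfg_scalarCfg_imag G
  -- the fine curvature
  set f : ℝ := ω / (L : ℝ) ^ (2 * k) with hfdef
  have hLk : (0 : ℝ) < (L : ℝ) ^ (2 * k) := by positivity
  have hfk : f * (L : ℝ) ^ (2 * k) = ω := by rw [hfdef]; field_simp
  have hfabs : |f| * (L : ℝ) ^ (2 * k) = |ω| := by rw [← hfk, abs_mul, abs_of_pos hLk]
  -- (1) the Landau field `Ũ_f` and its `k`-fold average, a Landau field of curvature `ω`
  obtain ⟨a', c', havg⟩ := avgIter_landau (n := n) (d := d) L hL f 0 0 k (by rw [hfabs]; exact hω)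
  set Λ : B7Prop1Explicit.Site (d + 2) → Fin (d + 2) → ℂ := fun x κ =>
    ((if κ = 1 then f * ((x 0 : ℤ) : ℝ) + 0 else if κ = 0 then (0 : ℝ) else 0 : ℝ) : ℂ) * Complex.I with hΛ
  set Λ' : B7Prop1Explicit.Site (d + 2) → Fin (d + 2) → ℂ := fun x κ =>
    ((if κ = 1 then (f * (L : ℝ) ^ (2 * k)) * ((x 0 : ℤ) : ℝ) + a' else if κ = 0 then c' else 0 : ℝ) : ℂ) * Complex.I with hΛ'
  have hΛF : ∀ x κ, Λ x κ = ((if κ = 1 then f * ((x 0 : ℤ) : ℝ) + 0 else if κ = 0 then (0 : ℝ) else 0 : ℝ) : ℂ) * Complex.I := fun _ _ => rfl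
  have hΛ'F : ∀ x κ, Λ' x κ = ((if κ = 1 then ω * ((x 0 : ℤ) : ℝ) + a' else if κ = 0 then c' else 0 : ℝ) : ℂ) * Complex.I := by
    intro x κ; rw [hΛ', hfk]
  -- (2) flux quantisation at the datum: `e^{iN²ω} = 1`, hence `e^{if(NL^k)²} = 1`
  have hq : Complex.exp ((((f * ((N * L ^ k : ℕ) : ℝ) ^ 2 : ℝ)) : ℂ) * Complex.I) = 1 := by
    have h := cexp_sq_mul_flux_eq_one (n := n) (κ := 0) (μ := 1) (ω := ω) _ hP (fun x => by
      rw [hcurv x 0 1 fin_zero_ne_one]; simp)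
    have : f * ((N * L ^ k : ℕ) : ℝ) ^ 2 = (N : ℝ) ^ 2 * ω := by
      rw [← hfk]; push_cast; ring
    rw [this]; exact h
  -- (3) the seam field `U₁` with period `P = N·L^k` and flux `f`
  set P : ℕ := N * L ^ k with hPdef
  have hP1 : 1 ≤ P := Nat.one_le_iff_ne_zero.mpr (Nat.mul_ne_zero (by omega) (pow_ne_zero _ (by omega)))
  set Sg : B7Prop1Explicit.Site (d + 2) → Fin (d + 2) → ℝ := fun x κ =>
    (if κ = 1 then f * (((x 0 % (P : ℤ) : ℤ)) : ℝ)
      else if κ = 0 then (if x 0 % (P : ℤ) = (P : ℤ) - 1 then -(f * P * (((x 1 % (P : ℤ) : ℤ)) : ℝ)) else 0) else 0 : ℝ) with hSg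
  set S : B7Prop1Explicit.Site (d + 2) → Fin (d + 2) → ℂ := fun x κ => ((Sg x κ : ℝ) : ℂ) * Complex.I with hSdef
  have hSF : ∀ x κ, S x κ = ((if κ = 1 then f * (((x 0 % (P : ℤ) : ℤ)) : ℝ)
      else if κ = 0 then (if x 0 % (P : ℤ) = (P : ℤ) - 1 then -(f * P * (((x 1 % (P : ℤ) : ℤ)) : ℝ)) else 0) else 0 : ℝ) : ℂ) * Complex.I := fun _ _ => rfl
  have hU₁U : IsUnitaryCfg (scalarCfg (n := n) S) := isUnitaryCfg_scalarCfg_imag Sg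
  have hU₁P : IsPeriodicCfg (scalarCfg (n := n) S) (P : ℤ) := isPeriodicCfg_seam (n := n) (d := d) (f := f) (P := P)
  have hU₁plaq := hol_plaqWord_seam (n := n) hSF hP1 hq
  -- (4a) `Ũ_f = U₁^{w}` with `w` central unitary
  have hŨU : IsUnitaryCfg (scalarCfg (n := n) Λ) := isUnitaryCfg_landau hΛF
  obtain ⟨w, hwU, hwc, hŨw⟩ := exists_central_gauge_of_hol_plaqWord_eq (n := n) hŨU hU₁U (fun x κ μ _ => by
    rw [hol_plaqWord_landau hΛF, hU₁plaq])
  -- (4b) `V = W^{v}`, `W = avgIter L Ũ_f k` the Landau field of curvature `ω`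
  have hWU : IsUnitaryCfg (scalarCfg (n := n) Λ') := isUnitaryCfg_landau hΛ'F
  obtain ⟨v, hvU, hvc, hVv⟩ := exists_central_gauge_of_hol_plaqWord_eq (n := n) (F := fun x κ => ((G x κ : ℝ) : ℂ) * Complex.I) hVU hWU
    (fun x κ μ hκμ => by rw [hcurv x κ μ hκμ, hol_plaqWord_landau hΛ'F])
  -- (5) `W = (avgIter L U₁ k)^{w ∘ L^k}`, so `V = (avgIter L U₁ k)^{y}`, `y = v · uLev w`
  have hW : scalarCfg (n := n) Λ' = gaugeAct (uLev L w k) (avgIter L (scalarCfg (n := n) S) k) := by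
    rw [← havg, hŨw, avgIter_gaugeAct_units]
  set y : B7Prop1Explicit.Site (d + 2) → (Matrix n n ℂ)ˣ := v * uLev L w k with hydef
  have hVy : V = gaugeAct y (avgIter L (scalarCfg (n := n) S) k) := by
    have h1 : V = gaugeAct v (scalarCfg (n := n) Λ') := hVv
    rw [h1, hW, gaugeAct_gaugeAct]
  have hyU : ∀ z, y z ∈ unitaryUnits (Matrix n n ℂ) := fun z =>
    (unitaryUnits (Matrix n n ℂ)).mul_mem (hvU z) (by rw [uLev_apply]; exact hwU _)
  have hyc : ∀ (z : B7Prop1Explicit.Site (d + 2)) (X : Matrix n n ℂ), (y z : Matrix n n ℂ) * X = X * y z := by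
    intro z X
    rw [hydef, Pi.mul_apply, Units.val_mul, uLev_apply, mul_assoc, hwc, ← mul_assoc, hvc, mul_assoc]
  -- (6) the averaged seam field is `N`-periodic; monodromy of `y`
  have hW₁P : IsPeriodicCfg (avgIter L (scalarCfg (n := n) S) k) (N : ℤ) := by
    refine isPeriodicCfg_avgIter' L k ?_
    have : (L : ℤ) ^ k * (N : ℤ) = (P : ℤ) := by rw [hPdef]; push_cast; ring
    rw [this]; exact hU₁P
  have hmono := monodromy_const hyc hW₁P (by rw [← hVy]; exact hP)
  -- (7) the preimage
  -- the plaquette variables of the preimage are the Landau field's (central gauge)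
  have hplaq : ∀ (x : B7Prop1Explicit.Site (d + 2)) (κ μ : Fin (d + 2)), hol (gaugeAct (fun x => y (blk (L ^ k) x)) (scalarCfg (n := n) S)) x (plaqWord κ μ)
      = expUnit ((((if κ = 0 ∧ μ = 1 then f else if κ = 1 ∧ μ = 0 then -f else 0 : ℝ) : ℂ) * Complex.I) • (1 : Matrix n n ℂ)) := by
    intro x κ μ
    rw [hol_gaugeAct_closed _ _ _ _ (disp_plaqWord κ μ), hU₁plaq x κ μ, ← hol_plaqWord_landau hΛF x κ μ]
    have hc := units_comm_of_central (hyc (blk (L ^ k) x)) (hol (scalarCfg (n := n) Λ) x (plaqWord κ μ))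
    rw [hc, mul_inv_cancel_right]
  refine ⟨gaugeAct (fun x => y (blk (L ^ k) x)) (scalarCfg (n := n) S), isUnitaryCfg_gaugeAct (fun x => hyU _) hU₁U, ?_, ?_, ?_, fun x κ μ => by
    rw [hplaq, hfdef]⟩
  · exact isPeriodicCfg_gaugeAct_blkGauge_of_monodromy (Nat.one_le_pow _ _ hL1) hyc hmono (by rw [← hPdef]; exact hU₁P)
  · refine smallField_gaugeAct (fun x => hyU _) ?_
    have hsf := smallField_landau (n := n) hΛF
    have hrad : |f| = |ω| / ((L : ℝ) ^ k) ^ 2 := by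
      rw [← hfabs, ← pow_mul, mul_comm k 2, mul_div_assoc, div_self hLk.ne', mul_one]
    intro x κ μ hκμ
    rw [hU₁plaq x κ μ, ← hol_plaqWord_landau hΛF x κ μ, ← hrad]
    exact hsf x κ μ hκμ
  · have h := avgIter_gaugeAct_blkGauge hL1 y (scalarCfg (n := n) S) k
    rw [h, ← hVy]

/-- **★★ (8) NON-EMPTY AT A `k`-UNIFORM RADIUS**: under the hypotheses of `exists_periodic_uniform_preimage`, the admissible set of run `k` over the class `sfClass (d+2) L N e k` at the
datum `V` is NON-EMPTY for every `e ≥ |ω|` — the class constant does not depend on `k`. [cite: Balaban1985Variational, (8) p.279] -/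
theorem nonempty_admissible_uniformScalar [Nonempty n] {L : ℕ} (hL : 2 ≤ L) {N : ℕ} (hN : 1 ≤ N) {ω : ℝ} (hω : |ω| ≤ 1 / 2)
    {G : B7Prop1Explicit.Site (d + 2) → Fin (d + 2) → ℝ}
    (hP : IsPeriodicCfg (scalarCfg (n := n) (fun x κ => ((G x κ : ℝ) : ℂ) * Complex.I)) (N : ℤ))
    (hcurv : ∀ (x : B7Prop1Explicit.Site (d + 2)) (κ μ : Fin (d + 2)), κ ≠ μ →
      hol (scalarCfg (n := n) (fun x κ => ((G x κ : ℝ) : ℂ) * Complex.I)) x (plaqWord κ μ)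
        = expUnit ((((if κ = 0 ∧ μ = 1 then ω else if κ = 1 ∧ μ = 0 then -ω else 0 : ℝ) : ℂ) * Complex.I) • (1 : Matrix n n ℂ)))
    (k : ℕ) {e : ℝ} (he : |ω| ≤ e) :
    (admissible (sfClass (d + 2) L N e) L k (scalarCfg (n := n) (fun x κ => ((G x κ : ℝ) : ℂ) * Complex.I))).Nonempty := by
  obtain ⟨U, hU, hUP, hUS, hUavg, -⟩ := exists_periodic_uniform_preimage hL hN hω hP hcurv k
  exact ⟨U, ⟨hU, hUP, SmallField.mono hUS (div_le_div_of_nonneg_right he (by positivity))⟩, hUavg⟩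

/-- **★★ A MINIMISER EXISTS AT A `k`-UNIFORM RADIUS** (leaf-05's compactness regime `16C₀(d+2)e ≤ 3`, `1024(d+3)(d+6)L²e ≤ 1`): under the hypotheses of
`exists_periodic_uniform_preimage`, run `k` of [Balaban1985Variational]'s variational problem over `sfClass (d+2) L N e` at the uniform-curvature scalar datum HAS A MINIMISER
for every `e ≥ |ω|` in the regime — for every `k`. [cite: Balaban1985Variational, Thm 1 (8) p.279] -/
theorem exists_isMinimiser_uniformScalar [Nonempty n] {L : ℕ} (hL : 2 ≤ L) {N : ℕ} (hN : 1 ≤ N) {ω : ℝ} (hω : |ω| ≤ 1 / 2)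
    {G : B7Prop1Explicit.Site (d + 2) → Fin (d + 2) → ℝ}
    (hP : IsPeriodicCfg (scalarCfg (n := n) (fun x κ => ((G x κ : ℝ) : ℂ) * Complex.I)) (N : ℤ))
    (hcurv : ∀ (x : B7Prop1Explicit.Site (d + 2)) (κ μ : Fin (d + 2)), κ ≠ μ →
      hol (scalarCfg (n := n) (fun x κ => ((G x κ : ℝ) : ℂ) * Complex.I)) x (plaqWord κ μ)
        = expUnit ((((if κ = 0 ∧ μ = 1 then ω else if κ = 1 ∧ μ = 0 then -ω else 0 : ℝ) : ℂ) * Complex.I) • (1 : Matrix n n ℂ)))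
    (k : ℕ) {e : ℝ} (he : |ω| ≤ e) (he1 : 16 * C0 (d + 2) * e ≤ 3) (he2 : 1024 * ((d + 2 : ℕ) + 1 : ℝ) * ((d + 2 : ℕ) + 4) * (L : ℝ) ^ 2 * e ≤ 1) :
    ∃ U, IsMinimiser (d + 2) (sfClass (d + 2) L N e) L N k (scalarCfg (n := n) (fun x κ => ((G x κ : ℝ) : ℂ) * Complex.I)) U :=
  exists_isMinimiser_of_nonempty hL ((abs_nonneg ω).trans he) he1 he2 (nonempty_admissible_uniformScalar hL hN hω hP hcurv k he)

/-- **★★★ THE SLOT KEY's (T8) ON THE UNIFORM-CURVATURE SCALAR DATA, `k`-UNIFORMLY** (every dimension `d+2`, `L ≥ 2`, `N ≥ 1`): for every `C : B11Thm1.Consts` with `2 ≤ C.B₃` and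
`C.B₃·C.a₁` inside leaf-05's compactness regime, the (T8) text of dag-n16-e's ∕ this seat's DischargeTest (`∀ k ε₁ ≤ C.a₁, ∀ V loose, ∃ U, IsMinimiser … (C.B₃·ε₁) … (k+1) V U`)
HOLDS with the datum ranging over the `ε₁`-loose SCALAR-PRESENTED data of UNIFORM `(e₀,e₁)`-CURVATURE (`|ω| ≤ 1`; the datum's radius `ε₁` is read from `V ∈ sfClass (d+2) L N ε₁ 0`
by Jordan's inequality `|ω| ≤ 2‖e^{iω}·1 − 1‖ ≤ 2ε₁ ≤ C.B₃ε₁`).  The first NON-FLAT data family on which the located content (C1) («`k`-uniform `B₃`») is settled.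
[cite: Balaban1985Variational, Thm 1 (8) p.279] -/
theorem exists8Min_on_uniformScalar [Nonempty n] {L : ℕ} (hL : 2 ≤ L) {N : ℕ} (hN : 1 ≤ N) (C : B11Thm1.Consts) (hB : 2 ≤ C.B₃)
    (hr1 : 16 * C0 (d + 2) * (C.B₃ * C.a₁) ≤ 3) (hr2 : 1024 * ((d + 2 : ℕ) + 1 : ℝ) * ((d + 2 : ℕ) + 4) * (L : ℝ) ^ 2 * (C.B₃ * C.a₁) ≤ 1) (hr3 : C.B₃ * C.a₁ ≤ 1 / 2) :
    ∀ (k : ℕ) (ε₁ : ℝ), 0 < ε₁ → ε₁ ≤ C.a₁ → ∀ V : B7Prop1Explicit.Site (d + 2) → Fin (d + 2) → (Matrix n n ℂ)ˣ, V ∈ sfClass (d + 2) L N ε₁ 0 →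
      V ∈ {V | ∃ (G : B7Prop1Explicit.Site (d + 2) → Fin (d + 2) → ℝ) (ω : ℝ), |ω| ≤ 1 ∧ V = scalarCfg (n := n) (fun x κ => ((G x κ : ℝ) : ℂ) * Complex.I) ∧
        ∀ (x : B7Prop1Explicit.Site (d + 2)) (κ μ : Fin (d + 2)), κ ≠ μ → hol V x (plaqWord κ μ)
          = expUnit ((((if κ = 0 ∧ μ = 1 then ω else if κ = 1 ∧ μ = 0 then -ω else 0 : ℝ) : ℂ) * Complex.I) • (1 : Matrix n n ℂ))} →
      ∃ U : B7Prop1Explicit.Site (d + 2) → Fin (d + 2) → (Matrix n n ℂ)ˣ, IsMinimiser (d + 2) (sfClass (d + 2) L N (C.B₃ * ε₁)) L N (k + 1) V U := by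
  intro k ε₁ hε₁ hε₁a V hV hD
  obtain ⟨G, ω, hω1, rfl, hcurv⟩ := hD
  have hB0 : 0 < C.B₃ := C.B₃_pos
  -- the datum's radius: `|ω| ≤ 2ε₁ ≤ C.B₃ ε₁`
  have hsmall := hV.2.2 0 0 1 fin_zero_ne_one
  rw [hcurv 0 0 1 fin_zero_ne_one, val_expUnit, ← cexp_smul_one, pow_zero, one_pow, div_one] at hsmall
  simp only [true_and, if_true] at hsmall
  have hωε : |ω| ≤ 2 * ε₁ :=
    (abs_le_two_mul_norm_cexp_smul_one_sub_one (hω1.trans (by have := Real.pi_gt_three; linarith))).trans (by linarith)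
  have hωB : |ω| ≤ C.B₃ * ε₁ := hωε.trans (by nlinarith)
  have hε : C.B₃ * ε₁ ≤ C.B₃ * C.a₁ := mul_le_mul_of_nonneg_left hε₁a hB0.le
  have hωhalf : |ω| ≤ 1 / 2 := hωB.trans (hε.trans hr3)
  have hPer : IsPeriodicCfg (scalarCfg (n := n) (fun x κ => ((G x κ : ℝ) : ℂ) * Complex.I)) (N : ℤ) := by simpa using hV.2.1
  refine exists_isMinimiser_uniformScalar hL hN hωhalf hPer hcurv (k + 1) hωB ?_ ?_
  · exact (mul_le_mul_of_nonneg_left hε (by have := C0_pos (d + 2); positivity)).trans hr1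
  · exact (mul_le_mul_of_nonneg_left hε (by positivity)).trans hr2

/-- **★★ … AND ON THEIR GAUGE SATURATION** (this seat's g5 `isMinimiser_gaugeAct_blkGauge`): the same (T8) text with the datum ranging over the unitary `N`-periodic gauge
orbits `𝒢_N · 𝒟_unif` of the uniform-curvature scalar data. [cite: Balaban1985Variational, Thm 1 (8) p.279] -/
theorem exists8Min_on_uniformScalar_saturation [Nonempty n] {L : ℕ} (hL : 2 ≤ L) {N : ℕ} (hN : 1 ≤ N) (C : B11Thm1.Consts) (hB : 2 ≤ C.B₃)
    (hr1 : 16 * C0 (d + 2) * (C.B₃ * C.a₁) ≤ 3) (hr2 : 1024 * ((d + 2 : ℕ) + 1 : ℝ) * ((d + 2 : ℕ) + 4) * (L : ℝ) ^ 2 * (C.B₃ * C.a₁) ≤ 1) (hr3 : C.B₃ * C.a₁ ≤ 1 / 2) :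
    ∀ (k : ℕ) (ε₁ : ℝ), 0 < ε₁ → ε₁ ≤ C.a₁ → ∀ V : B7Prop1Explicit.Site (d + 2) → Fin (d + 2) → (Matrix n n ℂ)ˣ,
      V ∈ {W | ∃ V₀ : B7Prop1Explicit.Site (d + 2) → Fin (d + 2) → (Matrix n n ℂ)ˣ, V₀ ∈ sfClass (d + 2) L N ε₁ 0 ∧
        (∃ (G : B7Prop1Explicit.Site (d + 2) → Fin (d + 2) → ℝ) (ω : ℝ), |ω| ≤ 1 ∧ V₀ = scalarCfg (n := n) (fun x κ => ((G x κ : ℝ) : ℂ) * Complex.I) ∧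
          ∀ (x : B7Prop1Explicit.Site (d + 2)) (κ μ : Fin (d + 2)), κ ≠ μ → hol V₀ x (plaqWord κ μ)
            = expUnit ((((if κ = 0 ∧ μ = 1 then ω else if κ = 1 ∧ μ = 0 then -ω else 0 : ℝ) : ℂ) * Complex.I) • (1 : Matrix n n ℂ))) ∧
        ∃ u : B7Prop1Explicit.Site (d + 2) → (Matrix n n ℂ)ˣ, NE3EnergyShapes.IsUnitarySite u ∧ NE3EnergyShapes.IsPeriodicSite u (N : ℤ) ∧ W = gaugeAct u V₀} →
      ∃ U : B7Prop1Explicit.Site (d + 2) → Fin (d + 2) → (Matrix n n ℂ)ˣ, IsMinimiser (d + 2) (sfClass (d + 2) L N (C.B₃ * ε₁)) L N (k + 1) V U := by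
  intro k ε₁ hε₁ hε₁a V hV
  obtain ⟨V₀, hV₀, hD, u, hu, huP, rfl⟩ := hV
  obtain ⟨U₀, hU₀⟩ := exists8Min_on_uniformScalar hL hN C hB hr1 hr2 hr3 k ε₁ hε₁ hε₁a V₀ hV₀ hD
  exact ⟨_, isMinimiser_gaugeAct_blkGauge (show 1 ≤ L by omega) hU₀ hu huP⟩

end

end Summit.QuantumFields.YangMills.BalabanUVNodes.N16Exists8UniformScalar
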